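import Summits.RiemannHypothesis.RiemannHypothesis.Theorems.CofiniteCriticalLine.Negative.HorizontalMonotonicity

/-!
# `CofiniteCriticalLine` (crux stmt-RiemannHypothesis-2064): the collar half of idea `rate-band-collar-split` is zero-location in costume

Companion of `HorizontalMonotonicity.lean` (crux ⟺ cofinite Lagarias positivity ⟺ cofinite Sondow–Dumitrescu
monotonicity of `σ ↦ |ξ(σ + it)|` on the whole half-line `[1/2, ∞)`). Refuter's standing-adversary output
(cdisprove cycle 2), kernel-checked, statements inline (the idea's bodies restated verbatim; no import of
`Cruxes/CofiniteCriticalLine/SketchIdeator3.lean`), no new definitions.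

The idea splits the crux as `RateBand(η) ∧ CollarMono(η)` — far half: every zero of height `≥ T₁` lies within
`C|t|^{-ε}` of the line; near half: `x ↦ |ξ(1/2 + x + it)|` is monotone on the collar `[0, C|t|^{-ε}]` for
`|t| ≥ T₂` (`FixedCollarMono ε₀ T`: on `[0, ε₀]`).

* `fixedCollarMono_of_cofinite`, `collarMono_of_cofinite` — the crux IMPLIES the near half at every fixed width
  and every rate; `rateBand_of_cofinite` — and the far half for every `C ≥ 0`; hence `splitExact_of_cofinite`
  PROVES the idea's `SplitExact` (nothing is lost by splitting).
* `cofinite_of_fixedCollarMono`, `fixedCollarMono_iff_cofinite` — at any fixed width `ε₀ ≥ 1/2` the near half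
  ALONE is equivalent to the crux (no `AsymptoticCriticalLine` needed): `FixedCollarMono (ε₀ ≥ 1/2)` is the crux in
  costume. At shrinking width the near half is implied by the crux and, given the far half at the same rate,
  implies it (the idea's `firstLemma_holds`): the split relocates the difficulty into the far half, it does not
  divide it. What decides monotonicity across the collar at height `t` is the set of off-line zeros at heights
  within `1/2` of `t` (`strictMonoOn_norm_riemannXi_of_offLine_height`).
* Degenerate parameters of `RateBand ε C T`: FALSE for `C < 0` (`not_rateBand_of_neg`: Hardy's theorem, proved in
  tree, plus discreteness — `exists_zero_on_line_abs_im_ge`); for `C = 0` it is the whole crux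
  (`rateBand_zero_iff_cofinite`); for `C > 0, ε > 0` it sits between rungs #4 and #5 (RH-implied, open).
-/

noncomputable section

open Complex Set Filter Topology
open scoped ComplexConjugate

namespace Summit.RiemannHypothesis.Cruxes.CofiniteCriticalLine.Negative

open Summit.RiemannHypothesis.RiemannHypothesis.Theses.RuelleBand
open Literature.NumberTheory.LFunctions

/-! ## Consequences for the collar statements of idea `rate-band-collar-split` -/

/-- The idea's `FixedCollarMono ε₀ T` (body restated verbatim: monotonicity of
`x ↦ |ξ(1/2 + x + it)|` on `[0, ε₀]` for `|t| ≥ T`) FOLLOWS from the crux at EVERY width `ε₀`. [folklore] -/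
theorem fixedCollarMono_of_cofinite (h : CofiniteCriticalLine) (ε₀ : ℝ) :
    ∃ T : ℝ, ∀ t : ℝ, T ≤ |t| →
      MonotoneOn (fun x : ℝ => ‖riemannXi (1 / 2 + x + t * Complex.I)‖) (Set.Icc 0 ε₀) := by
  obtain ⟨T, hT⟩ := eventually_strictMonoOn_of_cofinite h
  refine ⟨T, fun t ht => ?_⟩
  intro x hx y hy hxy
  have hmono := (hT t ht).monotoneOn
  have := hmono (a := 1 / 2 + x) (b := 1 / 2 + y) (by simp [hx.1]) (by simp [hy.1]) (by linarith)
  simpa [Complex.ofReal_add] using this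

/-- … and at any width `ε₀ ≥ 1/2` it IMPLIES the crux by itself (no `AsymptoticCriticalLine` needed):
so `∃ T, FixedCollarMono ε₀ T` with `ε₀ ≥ 1/2` is the crux in costume. [folklore] -/
theorem cofinite_of_fixedCollarMono {T ε₀ : ℝ} (hε₀ : 1 / 2 ≤ ε₀)
    (h : ∀ t : ℝ, T ≤ |t| →
      MonotoneOn (fun x : ℝ => ‖riemannXi (1 / 2 + x + t * Complex.I)‖) (Set.Icc 0 ε₀)) :
    CofiniteCriticalLine := by
  refine cofinite_of_eventually_monotoneOn hε₀ (T := T) fun t ht => ?_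
  intro a ha b hb hab
  have := h t ht (a := a - 1 / 2) (b := b - 1 / 2) ⟨by linarith [ha.1], by linarith [ha.2]⟩
    ⟨by linarith [hb.1], by linarith [hb.2]⟩ (by linarith)
  simpa [Complex.ofReal_sub] using this

/-- Hence, for `ε₀ ≥ 1/2`: `(∃ T, FixedCollarMono ε₀ T) ↔ CofiniteCriticalLine`. [folklore] -/
theorem fixedCollarMono_iff_cofinite {ε₀ : ℝ} (hε₀ : 1 / 2 ≤ ε₀) :
    (∃ T : ℝ, ∀ t : ℝ, T ≤ |t| →
      MonotoneOn (fun x : ℝ => ‖riemannXi (1 / 2 + x + t * Complex.I)‖) (Set.Icc 0 ε₀)) ↔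
    CofiniteCriticalLine :=
  ⟨fun ⟨_, h⟩ => cofinite_of_fixedCollarMono hε₀ h, fun h => fixedCollarMono_of_cofinite h ε₀⟩

/-- At a single height: if no off-line zero has ordinate within `1/2` of `t`, then `σ ↦ |ξ(σ + it)|` is
strictly increasing on `[1/2, ∞)` — monotonicity across the collar at height `t` is decided by the off-line
zeros at heights within `1/2` of `t` (and by nothing else). [folklore] -/
theorem strictMonoOn_norm_riemannXi_of_offLine_height {t : ℝ}
    (hfar : ∀ ρ : ℂ, riemannZeta ρ = 0 → 0 < ρ.re → ρ.re < 1 → ρ.re ≠ 1 / 2 → 1 / 2 ≤ |t - ρ.im|) :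
    StrictMonoOn (fun σ : ℝ => ‖riemannXi (σ + t * I)‖) (Ici (1 / 2)) :=
  strictMonoOn_norm_riemannXi_of_re_logDeriv_pos fun _ hσ =>
    re_logDeriv_riemannXi_pos_of_offLine_height hσ hfar

/-- The idea's `CollarMono ε C T₂` (body verbatim: monotonicity on the shrinking collar
`[0, C|t|^{-ε}]` for `|t| ≥ T₂`) FOLLOWS from the crux at every rate `(ε, C)`: the near half of the split
`Cofinite ⇔ RateBand(η) ∧ CollarMono(η)` is implied by the crux, so given the far half it IS the crux.
[folklore] -/
theorem collarMono_of_cofinite (h : CofiniteCriticalLine) (ε C : ℝ) :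
    ∃ T₂ : ℝ, ∀ t : ℝ, T₂ ≤ |t| →
      MonotoneOn (fun x : ℝ => ‖riemannXi (1 / 2 + x + t * Complex.I)‖) (Set.Icc 0 (C * |t| ^ (-ε))) := by
  obtain ⟨T, hT⟩ := eventually_strictMonoOn_of_cofinite h
  refine ⟨T, fun t ht => ?_⟩
  intro x hx y hy hxy
  have hmono := (hT t ht).monotoneOn
  have := hmono (a := 1 / 2 + x) (b := 1 / 2 + y) (by simp [hx.1]) (by simp [hy.1]) (by linarith)
  simpa [Complex.ofReal_add] using this

/-- The idea's `RateBand ε C T₁` (body verbatim) FOLLOWS from the crux for every `ε` and every `C ≥ 0`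
(above the exceptional heights the left side vanishes). [folklore] -/
theorem rateBand_of_cofinite (h : CofiniteCriticalLine) (ε C : ℝ) (hC : 0 ≤ C) :
    ∃ T₁ : ℝ, ∀ s : ℂ, riemannZeta s = 0 → 0 < s.re → s.re < 1 → T₁ ≤ |s.im| →
      |s.re - 1 / 2| ≤ C * |s.im| ^ (-ε) := by
  obtain ⟨T, hT⟩ := cofiniteCriticalLine_iff_eventually_on_line.1 h
  refine ⟨T + 1, fun s hz h0 h1 hs => ?_⟩
  rw [hT s hz h0 h1 (by linarith), sub_self, abs_zero]
  exact mul_nonneg hC (Real.rpow_nonneg (abs_nonneg _) _)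

/-- Hence the idea's `SplitExact` (crux ⟹ both halves at every rate, `C > 0`) is a THEOREM: nothing is
lost by the split — and nothing is gained on the near half, which the crux gives for free. [folklore] -/
theorem splitExact_of_cofinite (h : CofiniteCriticalLine) (ε C : ℝ) (hC : 0 < C) :
    ∃ T : ℝ,
      (∀ s : ℂ, riemannZeta s = 0 → 0 < s.re → s.re < 1 → T ≤ |s.im| → |s.re - 1 / 2| ≤ C * |s.im| ^ (-ε)) ∧
      (∀ t : ℝ, T ≤ |t| →
        MonotoneOn (fun x : ℝ => ‖riemannXi (1 / 2 + x + t * Complex.I)‖) (Set.Icc 0 (C * |t| ^ (-ε)))) := by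
  obtain ⟨T₁, h₁⟩ := rateBand_of_cofinite h ε C hC.le
  obtain ⟨T₂, h₂⟩ := collarMono_of_cofinite h ε C
  exact ⟨max T₁ T₂, fun s hz h0 h1 hs => h₁ s hz h0 h1 (le_trans (le_max_left _ _) hs),
    fun t ht => h₂ t (le_trans (le_max_right _ _) ht)⟩

/-! ## Degenerate parameters of `RateBand ε C T` -/

/-- There are zeros ON the line at arbitrarily large height (Hardy's theorem, proved in tree, plus
discreteness of the zeros). [folklore] -/
theorem exists_zero_on_line_abs_im_ge (M : ℝ) : ∃ t : ℝ, M ≤ |t| ∧ riemannZeta (1 / 2 + t * I) = 0 := by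
  by_contra hcon
  push Not at hcon
  have hsub : {t : ℝ | riemannZeta (1 / 2 + t * I) = 0} ⊆
      (fun t : ℝ => (1 / 2 : ℂ) + t * I) ⁻¹'
        ((Icc (0 : ℝ) 1 ×ℂ Icc (-M) M) ∩ {s : ℂ | riemannZeta s = 0}) := by
    intro t ht
    have hM : |t| < M := lt_of_not_ge fun h => hcon t h ht
    refine ⟨Complex.mem_reProdIm.2 ⟨?_, ?_⟩, ht⟩
    · simp; norm_num
    · simpa using abs_le.1 hM.le
  refine hardy_infinite_zeros_on_critical_line_holds ((Set.Finite.preimage ?_ ?_).subset hsub)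
  · intro a _ b _ hab
    simpa using congrArg Complex.im hab
  · exact ((isCompact_Icc (a := (0 : ℝ)) (b := 1)).reProdIm (isCompact_Icc (a := -M) (b := M)))
      |>.inter_riemannZetaZeros_finite

/-- `RateBand ε C T` with `C < 0` is FALSE (a zero on the line above height `max T 1` has left side `0` and
right side `< 0`): the constant must be non-negative. [folklore] -/
theorem not_rateBand_of_neg {ε C T : ℝ} (hC : C < 0) :
    ¬ ∀ s : ℂ, riemannZeta s = 0 → 0 < s.re → s.re < 1 → T ≤ |s.im| →
      |s.re - 1 / 2| ≤ C * |s.im| ^ (-ε) := by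
  intro h
  obtain ⟨t, ht, hz⟩ := exists_zero_on_line_abs_im_ge (max T 1)
  have h1 : (1 : ℝ) ≤ |t| := le_trans (le_max_right _ _) ht
  have hle := h (1 / 2 + t * I) hz (by simp) (by simp; norm_num) (by simpa using le_trans (le_max_left _ _) ht)
  have him : ((1 / 2 : ℂ) + t * I).im = t := by simp
  have hre : ((1 / 2 : ℂ) + t * I).re = 1 / 2 := by simp
  rw [him, hre, sub_self, abs_zero] at hle
  have hpow : 0 < |t| ^ (-ε) := Real.rpow_pos_of_pos (by linarith) _
  nlinarith

/-- `RateBand ε 0 T` (constant `C = 0`) says "every zero of height `≥ T` is on the line": so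
`(∃ T, RateBand ε 0 T) ↔ CofiniteCriticalLine` — at `C = 0` the far half is the whole crux. [folklore] -/
theorem rateBand_zero_iff_cofinite (ε : ℝ) :
    (∃ T : ℝ, ∀ s : ℂ, riemannZeta s = 0 → 0 < s.re → s.re < 1 → T ≤ |s.im| →
      |s.re - 1 / 2| ≤ 0 * |s.im| ^ (-ε)) ↔ CofiniteCriticalLine := by
  constructor
  · rintro ⟨T, hT⟩
    refine cofiniteCriticalLine_iff_eventually_on_line.2 ⟨T, fun s hz h0 h1 hs => ?_⟩
    have := hT s hz h0 h1 hs.le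
    rw [zero_mul] at this
    have h0' : |s.re - 1 / 2| = 0 := le_antisymm this (abs_nonneg _)
    linarith [abs_eq_zero.1 h0']
  · intro h
    exact rateBand_of_cofinite h ε 0 le_rfl

end Summit.RiemannHypothesis.Cruxes.CofiniteCriticalLine.Negative

end
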